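import Mathlib
import HarnessLib
import Summits.HubbardSuperconductivity.HubbardSuperconductivity.Theorems.KLProgrammeKLRegimeEngineLastStepFrameIdentity
import Literature.Probability.LatticeModels.TorusFourierWeightedConvolution

/-!
# K3 gen-8-FLOW (stmt 20437, stub (C), located item #20, cure (δ′) «LAST-STEP SWAP», layer F3g): the moments of the ODD-AVERAGE datum of the last-step
# response are `(π/β)`× the moments of `1 − klFieldStrength … K_N N` — the `hMm_c/hMs_c` inputs of `lastResponse_bracket(_flow/_sharp)` in the field-strength currency

Cell gate-hubbard-kl, seat p2 g17.  The third dressed datum of the response door is `h_c(k⃗) = ¼Σ_σ[Im Σ_N[K_N](ω₀,k⃗,σ) − Im Σ_N[K_N](−ω₀,k⃗,σ)]`; by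
`quarter_sum_im_sub_eq_mul_one_sub_klFieldStrength` (p605744) it IS `(π/β)·(1 − klFieldStrength … K_N N k⃗)` — the frequency-ODD mass that the class-#7 TIME
row / the (E3d) field-strength clause sizes (`|z − 1| ≤ Zt·U²`).  Since the inverse torus transform is linear, every weighted moment of `𝔉⁻¹[h_c]` is `(π/β)` times
the same moment of `𝔉⁻¹[1 − z]`: a supplier states the moments of `1 − klFieldStrength` (second order in `U`, its natural currency) and the bracket's `Zc`-row
(`PP_c ≤ Zc·U²·lʲ/l`) inherits the ONE scale gain `π/β ≤ (1/32)/4^{n_β}` (`pi_div_le_Z_div_four_pow_nScales`).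

* `torusFourierInv_oddAverage_eq` (pointwise: `𝔉⁻¹[h_c] = (π/β)·𝔉⁻¹[1 − z]`), **`moments_oddAverage_le_of_fieldStrength`** (every weight).

Proofs only; no definitions; nothing asserts superconductivity.  Refs: BGM 2006 §2.2 (2.23), §2.4 (2.36) [cite: BenfattoGiulianiMastropietro2006].
-/

noncomputable section

namespace Summit.HubbardSuperconductivity.HubbardSuperconductivity.Theorems.EngineV8

set_option linter.dupNamespace false -- summit = problem name (single-conjunct summit), D-0017

open Real Finset Literature.MathematicalPhysics.QuantumLattice Literature.Probability.LatticeModels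
open Summit.HubbardSuperconductivity.HubbardSuperconductivity.Theorems.KLRegimeSplit
open Summit.HubbardSuperconductivity.HubbardSuperconductivity.Theorems.DispersionFlow
open Summit.HubbardSuperconductivity.HubbardSuperconductivity.Theorems.KLProgrammeLegKernels

variable {L M : ℕ} [NeZero L] [NeZero M]

/-- **Pointwise**: the inverse transform of the odd-average datum is `(π/β)` times that of `1 − klFieldStrength`. -/
theorem torusFourierInv_oddAverage_eq {β : ℝ} (hβ0 : β ≠ 0) (U μ : ℝ) (K : TrigPolyC4v) (N : ℕ) (x : TorusSite 2 L) :
    torusFourierInv (fun k : TorusSite 2 L =>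
        ((((∑ σ : Fin 2, ((klSelfEnergy L M β U μ K klE0 N (omega0 M, k) σ).im -
          (klSelfEnergy L M β U μ K klE0 N ((omega0 M).rev, k) σ).im)) / 4 : ℝ)) : ℂ)) x =
      ((Real.pi / β : ℝ) : ℂ) * torusFourierInv (fun k : TorusSite 2 L => (((1 - klFieldStrength L M β U μ K N k : ℝ)) : ℂ)) x := by
  rw [← torusFourierInv_const_mul]
  congr 1
  funext k
  rw [quarter_sum_im_sub_eq_mul_one_sub_klFieldStrength hβ0 U μ K N k]
  push_cast
  ring

/-- **Moments of the odd-average datum from the field-strength moments**: for ANY nonnegative weight `w`, if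
`Σ_x w(x)·‖𝔉⁻¹[1 − z](x)‖ ≤ Mz` then `Σ_x w(x)·‖𝔉⁻¹[h_c](x)‖ ≤ (π/β)·Mz` (`0 < β`). -/
theorem moments_oddAverage_le_of_fieldStrength {β : ℝ} (hβ : 0 < β) (U μ : ℝ) (K : TrigPolyC4v) (N : ℕ) (w : TorusSite 2 L → ℝ)
    {Mz : ℝ} (hMz : ∑ x : TorusSite 2 L, w x * ‖torusFourierInv (fun k : TorusSite 2 L => (((1 - klFieldStrength L M β U μ K N k : ℝ)) : ℂ)) x‖ ≤ Mz) :
    ∑ x : TorusSite 2 L, w x * ‖torusFourierInv (fun k : TorusSite 2 L =>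
        ((((∑ σ : Fin 2, ((klSelfEnergy L M β U μ K klE0 N (omega0 M, k) σ).im -
          (klSelfEnergy L M β U μ K klE0 N ((omega0 M).rev, k) σ).im)) / 4 : ℝ)) : ℂ)) x‖ ≤ (Real.pi / β) * Mz := by
  have hw0 : 0 ≤ Real.pi / β := by positivity
  have e : ∀ x : TorusSite 2 L, w x * ‖torusFourierInv (fun k : TorusSite 2 L =>
        ((((∑ σ : Fin 2, ((klSelfEnergy L M β U μ K klE0 N (omega0 M, k) σ).im -
          (klSelfEnergy L M β U μ K klE0 N ((omega0 M).rev, k) σ).im)) / 4 : ℝ)) : ℂ)) x‖ =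
      (Real.pi / β) * (w x * ‖torusFourierInv (fun k : TorusSite 2 L => (((1 - klFieldStrength L M β U μ K N k : ℝ)) : ℂ)) x‖) := by
    intro x
    rw [torusFourierInv_oddAverage_eq hβ.ne' U μ K N x, norm_mul, Complex.norm_real, Real.norm_eq_abs, abs_of_nonneg hw0]
    ring
  simp_rw [e]
  rw [← mul_sum]
  exact mul_le_mul_of_nonneg_left hMz hw0

end Summit.HubbardSuperconductivity.HubbardSuperconductivity.Theorems.EngineV8

end
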